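import Mathlib
import Summits.MatrixMultiplication.MatrixMultiplication.Theorems.SnSubsetDichotomyHyperoctahedralThresholdRotationIdentity

/-!
# Twin defects under rotation: incidences of dirty twin pre-pairs are `ℓ ×` based counts
(crux `SnSubsetDichotomy.HyperoctahedralThreshold`, stmt-MatrixMultiplication-10883, line `refutation-local-symmetry`,
open core `stub_poorRigidCore`; siege seat k18, variation "twins ℓ² argument"; `--supports` helper, first file of two)

Vocabulary of the line: three involutions `μ c` of `Fin n`; a colour word `z : List (Fin 3)` acts on the right,
`x · z := z.foldl (fun v c => μ c v) x`; `z` is CYCLICALLY REDUCED when `List.IsChain (· ≠ ·) (z ++ z)`; the cyclically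
reduced words of length `ℓ` are written `((univ : Finset (List.Vector (Fin 3) ℓ)).image toList).filter (IsChain (· ≠ ·) (z ++ z))`
(as in `…RotationIdentity`).  A TWIN PRE-PAIR is `(z; x, y)` with `x ≠ y` both fixed by `z`; its rung walk
`t ↦ {x · z.take t, y · z.take t}` is clean unless some DEFECT INCIDENCE occurs:

* SELF: `x · z.take s = x · z.take t` for some `s < t < ℓ` (the trajectory of `x` is not simple);
* CROSS: `x · z.take s = y · z.take t` for some `s, t < ℓ` (then `s ≠ t`);
* R-HIT: `x · z.take t ∈ R` for some `t < ℓ` (the trajectory meets the forbidden set).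

The ROTATION TRICK (crux NOTES §11 "DEFECTS ≤ ℓ·Σ …", LeadC1-PoorCore §3–4): rotating the word by `s` and moving the
base points to their `s`-th trajectory points is a bijection of based closed walks (`Rotation.foldl_rotate_fixed_iff`,
landed p111510), under which an incidence at times `(s, t)` becomes an incidence at times `(0, t − s)`.  Hence
(`selfInc_le`, `crossInc_le`, `rHit_le`), for every `ℓ`:

  `#SELF-incidences ≤ ℓ · S₁`,  `S₁ := #{(z, d, p, y) : 0 < d < ℓ, p · z = p, p · z.take d = p, y · z = y, y ≠ p}`
                                  (based closed walks RETURNING to the base at time `d`, times the other fixed points);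
  `#CROSS-incidences ≤ ℓ · Ξ`,  `Ξ := #{(z, y, e) : 0 < e < ℓ, y · z = y, (y · z.take e) · z = y · z.take e ≠ y}`
                                  (SLIDES: a fixed point whose own trajectory point is again a fixed point — the (WM)
                                  quantity of crux NOTES §11);
  `#R-HIT-incidences ≤ ℓ · RInc`, `RInc := #{(z, x, y) : x ≠ y, x · z = x, y · z = y, x ∈ R}`.

The second file (`…TwinsEll2`) subtracts these from the twin supply `Pairs := #{(z, x, y) : x ≠ y both fixed}` and
extracts a clean `R`-avoiding twin in the format of the core's conclusion.  Pure finite combinatorics; the only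
hypothesis is `μ c * μ c = 1`.  No definitions are introduced.
-/

set_option linter.dupNamespace false

namespace Summit.MatrixMultiplication.MatrixMultiplication.Theorems.HyperoctahedralThreshold

namespace TwinsEll2

open Finset Rotation

variable {n : ℕ}

/-! ### Trajectories along a rotated word -/

/-- For a fixed point `y` of `z` and `s, e < |z|`: walking `e` steps along `z.rotate s` from the `s`-th trajectory
point of `y` lands on the `((s + e) % |z|)`-th trajectory point of `y` (the trajectory of a fixed point is periodic). -/
theorem foldl_take_rotate (μ : Fin 3 → Equiv.Perm (Fin n)) {z : List (Fin 3)} {y : Fin n}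
    (hy : z.foldl (fun v c => μ c v) y = y) {s e : ℕ} (hs : s < z.length) (he : e < z.length) :
    ((z.rotate s).take e).foldl (fun v c => μ c v) ((z.take s).foldl (fun v c => μ c v) y) =
      (z.take ((s + e) % z.length)).foldl (fun v c => μ c v) y := by
  rw [← List.foldl_append, List.rotate_eq_drop_append_take hs.le, List.take_append, List.length_drop,
    List.take_take, ← List.append_assoc, ← List.take_add]
  rcases lt_or_ge (s + e) z.length with h | h
  · have h1 : min (e - (z.length - s)) s = 0 := by omega
    rw [h1, List.take_zero, List.append_nil, Nat.mod_eq_of_lt h]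
  · have h1 : min (e - (z.length - s)) s = s + e - z.length := by omega
    have h2 : (s + e) % z.length = s + e - z.length := by
      rw [Nat.mod_eq_sub_mod h, Nat.mod_eq_of_lt (by omega)]
    rw [h1, h2, List.foldl_append, List.take_of_length_le h, hy]

/-- The `s`-th trajectory point of a fixed point of `z` is a fixed point of `z.rotate s`. -/
theorem foldl_rotate_fixed (μ : Fin 3 → Equiv.Perm (Fin n)) (hμ : ∀ c, μ c * μ c = 1) {z : List (Fin 3)}
    {x : Fin n} (hx : z.foldl (fun v c => μ c v) x = x) {s : ℕ} (hs : s ≤ z.length) :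
    (z.rotate s).foldl (fun v c => μ c v) ((z.take s).foldl (fun v c => μ c v) x) =
      (z.take s).foldl (fun v c => μ c v) x :=
  (foldl_rotate_fixed_iff μ hμ hs x).2 hx

/-! ### SELF incidences -/

/-- **Self-coincidence incidences are `ℓ ×` returns.**  The tuples `(z, x, y, s, t)` — `z` cyclically reduced of
length `ℓ`, `x ≠ y` fixed by `z`, `s < t < ℓ`, `x · z.take s = x · z.take t` — inject, via
`(z, x, y, s, t) ↦ (s; z.rotate s, t − s, x · z.take s, y · z.take s)`, into `range ℓ ×` the tuples `(z', d, p, y')` with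
`0 < d < ℓ`, `p · z' = p`, `p · z'.take d = p`, `y' · z' = y'`, `y' ≠ p`. [crux NOTES §11; LeadC1-PoorCore §3] -/
theorem selfInc_le (μ : Fin 3 → Equiv.Perm (Fin n)) (hμ : ∀ c, μ c * μ c = 1) (ℓ : ℕ) :
    (((((univ : Finset (List.Vector (Fin 3) ℓ)).image (fun v => v.toList)).filter
        (fun z => List.IsChain (· ≠ ·) (z ++ z))) ×ˢ (univ : Finset (Fin n)) ×ˢ (univ : Finset (Fin n)) ×ˢ
        range ℓ ×ˢ range ℓ).filter (fun t =>
          t.1.foldl (fun v c => μ c v) t.2.1 = t.2.1 ∧ t.1.foldl (fun v c => μ c v) t.2.2.1 = t.2.2.1 ∧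
          t.2.1 ≠ t.2.2.1 ∧ t.2.2.2.1 < t.2.2.2.2 ∧
          (t.1.take t.2.2.2.1).foldl (fun v c => μ c v) t.2.1 =
            (t.1.take t.2.2.2.2).foldl (fun v c => μ c v) t.2.1)).card ≤
      ℓ * (((((univ : Finset (List.Vector (Fin 3) ℓ)).image (fun v => v.toList)).filter
        (fun z => List.IsChain (· ≠ ·) (z ++ z))) ×ˢ range ℓ ×ˢ (univ : Finset (Fin n)) ×ˢ
        (univ : Finset (Fin n))).filter (fun t =>
          0 < t.2.1 ∧ t.1.foldl (fun v c => μ c v) t.2.2.1 = t.2.2.1 ∧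
          (t.1.take t.2.1).foldl (fun v c => μ c v) t.2.2.1 = t.2.2.1 ∧
          t.1.foldl (fun v c => μ c v) t.2.2.2 = t.2.2.2 ∧ t.2.2.2 ≠ t.2.2.1)).card := by
  rw [← card_range ℓ, ← card_product]
  rw [card_range ℓ]
  refine card_le_card_of_injOn
    (fun t => (t.2.2.2.1, t.1.rotate t.2.2.2.1, t.2.2.2.2 - t.2.2.2.1,
      (t.1.take t.2.2.2.1).foldl (fun v c => μ c v) t.2.1, (t.1.take t.2.2.2.1).foldl (fun v c => μ c v) t.2.2.1))
    ?_ ?_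
  · -- maps into
    rintro ⟨z, x, y, s, t⟩ h
    rw [mem_coe, mem_filter] at h
    obtain ⟨hmem, hx, hy, hxy, hst, hcoin⟩ := h
    simp only [mem_product, mem_univ, true_and, mem_range] at hmem
    obtain ⟨hz, hs, ht⟩ := hmem
    dsimp only at hx hy hxy hst hcoin hz hs ht
    have hzl : z.length = ℓ := (mem_cycWords.1 hz).1
    simp only
    rw [mem_coe, mem_product, mem_filter]
    refine ⟨mem_range.2 hs, ?_, ?_, ?_, ?_, ?_, ?_⟩
    · simp only [mem_product, mem_univ, mem_range, and_true]
      exact ⟨rotate_mem_cycWords hz s, by omega⟩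
    · show 0 < t - s
      omega
    · exact foldl_rotate_fixed μ hμ hx (by omega)
    · show ((z.rotate s).take (t - s)).foldl (fun v c => μ c v) ((z.take s).foldl (fun v c => μ c v) x) =
        (z.take s).foldl (fun v c => μ c v) x
      rw [foldl_take_rotate μ hx (by omega) (by omega)]
      have : (s + (t - s)) % z.length = t := by
        rw [Nat.add_sub_cancel' hst.le, Nat.mod_eq_of_lt (by omega)]
      rw [this]
      exact hcoin.symm
    · exact foldl_rotate_fixed μ hμ hy (by omega)
    · intro h
      exact hxy ((foldl_act_injective μ hμ (z.take s)) h).symm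
  · -- injective
    rintro ⟨z₁, x₁, y₁, s₁, t₁⟩ h₁ ⟨z₂, x₂, y₂, s₂, t₂⟩ h₂ heq
    rw [mem_coe, mem_filter] at h₁ h₂
    simp only [Prod.mk.injEq] at heq
    obtain ⟨hs, hz, hd, hx, hy⟩ := heq
    subst hs
    have hz' : z₁ = z₂ := List.rotate_eq_rotate.1 hz
    subst hz'
    have hx' : x₁ = x₂ := foldl_act_injective μ hμ (z₁.take s₁) hx
    have hy' : y₁ = y₂ := foldl_act_injective μ hμ (z₁.take s₁) hy
    subst hx' hy'
    have ht : t₁ = t₂ := by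
      have h1 := h₁.2.2.2.2.1
      have h2 := h₂.2.2.2.2.1
      simp only at h1 h2
      omega
    rw [ht]

/-! ### CROSS incidences -/

/-- **Cross-coincidence incidences are `ℓ ×` slides.**  The tuples `(z, x, y, s, t)` — `z` cyclically reduced of length
`ℓ`, `x ≠ y` fixed by `z`, `s, t < ℓ`, `x · z.take s = y · z.take t` — inject, via
`(z, x, y, s, t) ↦ (s; z.rotate s, y · z.take s, (t + (ℓ − s)) % ℓ)`, into `range ℓ ×` the slide tuples `(z', y', e)` with
`0 < e < ℓ`, `y' · z' = y'`, `(y' · z'.take e) · z' = y' · z'.take e ≠ y'` (the point `y' · z'.take e` is the transported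
`x`, recovered from `(z', y', e)`; `e ≠ 0` because `s = t` would force `x = y`). [crux NOTES §4, §11 (slides Ξ)] -/
theorem crossInc_le (μ : Fin 3 → Equiv.Perm (Fin n)) (hμ : ∀ c, μ c * μ c = 1) (ℓ : ℕ) :
    (((((univ : Finset (List.Vector (Fin 3) ℓ)).image (fun v => v.toList)).filter
        (fun z => List.IsChain (· ≠ ·) (z ++ z))) ×ˢ (univ : Finset (Fin n)) ×ˢ (univ : Finset (Fin n)) ×ˢ
        range ℓ ×ˢ range ℓ).filter (fun t =>
          t.1.foldl (fun v c => μ c v) t.2.1 = t.2.1 ∧ t.1.foldl (fun v c => μ c v) t.2.2.1 = t.2.2.1 ∧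
          t.2.1 ≠ t.2.2.1 ∧
          (t.1.take t.2.2.2.1).foldl (fun v c => μ c v) t.2.1 =
            (t.1.take t.2.2.2.2).foldl (fun v c => μ c v) t.2.2.1)).card ≤
      ℓ * (((((univ : Finset (List.Vector (Fin 3) ℓ)).image (fun v => v.toList)).filter
        (fun z => List.IsChain (· ≠ ·) (z ++ z))) ×ˢ (univ : Finset (Fin n)) ×ˢ range ℓ).filter (fun t =>
          0 < t.2.2 ∧ t.1.foldl (fun v c => μ c v) t.2.1 = t.2.1 ∧
          t.1.foldl (fun v c => μ c v) ((t.1.take t.2.2).foldl (fun v c => μ c v) t.2.1) =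
            (t.1.take t.2.2).foldl (fun v c => μ c v) t.2.1 ∧
          (t.1.take t.2.2).foldl (fun v c => μ c v) t.2.1 ≠ t.2.1)).card := by
  rw [← card_range ℓ, ← card_product]
  rw [card_range ℓ]
  refine card_le_card_of_injOn
    (fun t => (t.2.2.2.1, t.1.rotate t.2.2.2.1, (t.1.take t.2.2.2.1).foldl (fun v c => μ c v) t.2.2.1,
      (t.2.2.2.2 + (ℓ - t.2.2.2.1)) % ℓ))
    ?_ ?_
  · -- maps into
    rintro ⟨z, x, y, s, t⟩ h
    rw [mem_coe, mem_filter] at h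
    obtain ⟨hmem, hx, hy, hxy, hcoin⟩ := h
    simp only [mem_product, mem_univ, true_and, mem_range] at hmem
    obtain ⟨hz, hs, ht⟩ := hmem
    dsimp only at hx hy hxy hcoin hz hs ht
    have hzl : z.length = ℓ := (mem_cycWords.1 hz).1
    have hℓ : 0 < ℓ := by omega
    -- `s ≠ t`: equal times would force `x = y`
    have hst : s ≠ t := by
      rintro rfl
      exact hxy (foldl_act_injective μ hμ (z.take s) hcoin)
    -- the offset `e` and the transported point
    have he : (t + (ℓ - s)) % ℓ < ℓ := Nat.mod_lt _ hℓ
    have hse : (s + (t + (ℓ - s)) % ℓ) % ℓ = t := by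
      rw [Nat.add_mod, Nat.mod_mod, ← Nat.add_mod, ← Nat.add_assoc, Nat.add_comm s t, Nat.add_assoc,
        Nat.add_sub_cancel' hs.le, Nat.add_mod_right, Nat.mod_eq_of_lt ht]
    have hpt : ((z.rotate s).take ((t + (ℓ - s)) % ℓ)).foldl (fun v c => μ c v)
        ((z.take s).foldl (fun v c => μ c v) y) = (z.take s).foldl (fun v c => μ c v) x := by
      rw [foldl_take_rotate μ hy (by omega) (by rw [hzl]; exact he), hzl, hse]
      exact hcoin.symm
    simp only
    rw [mem_coe, mem_product, mem_filter]
    refine ⟨mem_range.2 hs, ?_, ?_, ?_, ?_, ?_⟩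
    · simp only [mem_product, mem_univ, mem_range, true_and]
      exact ⟨rotate_mem_cycWords hz s, he⟩
    · show 0 < (t + (ℓ - s)) % ℓ
      rcases Nat.eq_zero_or_pos ((t + (ℓ - s)) % ℓ) with h0 | h0
      · exfalso
        apply hst
        rw [h0, Nat.add_zero, Nat.mod_eq_of_lt hs] at hse
        exact hse
      · exact h0
    · exact foldl_rotate_fixed μ hμ hy (by omega)
    · show (z.rotate s).foldl (fun v c => μ c v) (((z.rotate s).take ((t + (ℓ - s)) % ℓ)).foldl (fun v c => μ c v)
          ((z.take s).foldl (fun v c => μ c v) y)) =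
        ((z.rotate s).take ((t + (ℓ - s)) % ℓ)).foldl (fun v c => μ c v) ((z.take s).foldl (fun v c => μ c v) y)
      rw [hpt]
      exact foldl_rotate_fixed μ hμ hx (by omega)
    · show ((z.rotate s).take ((t + (ℓ - s)) % ℓ)).foldl (fun v c => μ c v)
          ((z.take s).foldl (fun v c => μ c v) y) ≠ (z.take s).foldl (fun v c => μ c v) y
      rw [hpt]
      intro h
      exact hxy (foldl_act_injective μ hμ (z.take s) h)
  · -- injective
    rintro ⟨z₁, x₁, y₁, s₁, t₁⟩ h₁ ⟨z₂, x₂, y₂, s₂, t₂⟩ h₂ heq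
    rw [mem_coe, mem_filter] at h₁ h₂
    simp only [Prod.mk.injEq] at heq
    obtain ⟨hs, hz, hy, he⟩ := heq
    subst hs
    have hz' : z₁ = z₂ := List.rotate_eq_rotate.1 hz
    subst hz'
    have hy' : y₁ = y₂ := foldl_act_injective μ hμ (z₁.take s₁) hy
    subst hy'
    obtain ⟨hmem₁, -, -, -, hcoin₁⟩ := h₁
    obtain ⟨hmem₂, -, -, -, hcoin₂⟩ := h₂
    simp only [mem_product, mem_univ, true_and, mem_range] at hmem₁ hmem₂ hcoin₁ hcoin₂
    obtain ⟨-, hs, ht₁⟩ := hmem₁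
    obtain ⟨-, -, ht₂⟩ := hmem₂
    -- recover `t` from `e`
    have hrec : ∀ t < ℓ, (s₁ + (t + (ℓ - s₁)) % ℓ) % ℓ = t := fun t ht => by
      rw [Nat.add_mod, Nat.mod_mod, ← Nat.add_mod, ← Nat.add_assoc, Nat.add_comm s₁ t, Nat.add_assoc,
        Nat.add_sub_cancel' hs.le, Nat.add_mod_right, Nat.mod_eq_of_lt ht]
    have ht : t₁ = t₂ := by rw [← hrec t₁ ht₁, ← hrec t₂ ht₂, he]
    subst ht
    -- recover `x` from the coincidence
    have hx : x₁ = x₂ := foldl_act_injective μ hμ (z₁.take s₁) (hcoin₁.trans hcoin₂.symm)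
    rw [hx]

/-! ### R-HIT incidences -/

/-- **`R`-hit incidences are `ℓ ×` twin pre-pairs based in `R`.**  The tuples `(z, x, y, t)` — `z` cyclically reduced
of length `ℓ`, `x ≠ y` fixed by `z`, `t < ℓ`, `x · z.take t ∈ R` — inject, via
`(z, x, y, t) ↦ (t; z.rotate t, x · z.take t, y · z.take t)`, into `range ℓ ×` the twin pre-pairs `(z', x', y')` with
`x' ∈ R` (the bijection trick of crux NOTES §2 (S-avoid), §C4). -/
theorem rHit_le (μ : Fin 3 → Equiv.Perm (Fin n)) (hμ : ∀ c, μ c * μ c = 1) (R : Finset (Fin n)) (ℓ : ℕ) :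
    (((((univ : Finset (List.Vector (Fin 3) ℓ)).image (fun v => v.toList)).filter
        (fun z => List.IsChain (· ≠ ·) (z ++ z))) ×ˢ (univ : Finset (Fin n)) ×ˢ (univ : Finset (Fin n)) ×ˢ
        range ℓ).filter (fun t =>
          t.1.foldl (fun v c => μ c v) t.2.1 = t.2.1 ∧ t.1.foldl (fun v c => μ c v) t.2.2.1 = t.2.2.1 ∧
          t.2.1 ≠ t.2.2.1 ∧ (t.1.take t.2.2.2).foldl (fun v c => μ c v) t.2.1 ∈ R)).card ≤
      ℓ * (((((univ : Finset (List.Vector (Fin 3) ℓ)).image (fun v => v.toList)).filter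
        (fun z => List.IsChain (· ≠ ·) (z ++ z))) ×ˢ (univ : Finset (Fin n)) ×ˢ (univ : Finset (Fin n))).filter
        (fun t => t.1.foldl (fun v c => μ c v) t.2.1 = t.2.1 ∧ t.1.foldl (fun v c => μ c v) t.2.2 = t.2.2 ∧
          t.2.1 ≠ t.2.2 ∧ t.2.1 ∈ R)).card := by
  rw [← card_range ℓ, ← card_product]
  rw [card_range ℓ]
  refine card_le_card_of_injOn
    (fun t => (t.2.2.2, t.1.rotate t.2.2.2, (t.1.take t.2.2.2).foldl (fun v c => μ c v) t.2.1,
      (t.1.take t.2.2.2).foldl (fun v c => μ c v) t.2.2.1))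
    ?_ ?_
  · -- maps into
    rintro ⟨z, x, y, t⟩ h
    rw [mem_coe, mem_filter] at h
    obtain ⟨hmem, hx, hy, hxy, hR⟩ := h
    simp only [mem_product, mem_univ, true_and, mem_range] at hmem
    obtain ⟨hz, ht⟩ := hmem
    dsimp only at hx hy hxy hR hz ht
    have hzl : z.length = ℓ := (mem_cycWords.1 hz).1
    simp only
    rw [mem_coe, mem_product, mem_filter]
    refine ⟨mem_range.2 ht, ?_, ?_, ?_, ?_, hR⟩
    · simp only [mem_product, mem_univ, and_true]
      exact rotate_mem_cycWords hz t
    · exact foldl_rotate_fixed μ hμ hx (by omega)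
    · exact foldl_rotate_fixed μ hμ hy (by omega)
    · intro h
      exact hxy (foldl_act_injective μ hμ (z.take t) h)
  · -- injective
    rintro ⟨z₁, x₁, y₁, t₁⟩ - ⟨z₂, x₂, y₂, t₂⟩ - heq
    simp only [Prod.mk.injEq] at heq
    obtain ⟨ht, hz, hx, hy⟩ := heq
    subst ht
    have hz' : z₁ = z₂ := List.rotate_eq_rotate.1 hz
    subst hz'
    rw [foldl_act_injective μ hμ (z₁.take t₁) hx, foldl_act_injective μ hμ (z₁.take t₁) hy]

/-- **Registered form** (`stub_twinCrossRotation`, a `--supports` sub-goal of crux stmt-MatrixMultiplication-10883):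
cross-coincidence incidences of twin pre-pairs of length `ℓ` number at most `ℓ ×` the slides, `crossInc_le` fully
quantified. -/
theorem stub_twinCrossRotation : ∀ (n ℓ : ℕ) (μ : Fin 3 → Equiv.Perm (Fin n)), (∀ c, μ c * μ c = 1) → (((((Finset.univ : Finset (List.Vector (Fin 3) ℓ)).image (fun v => v.toList)).filter (fun z => List.IsChain (· ≠ ·) (z ++ z))) ×ˢ (Finset.univ : Finset (Fin n)) ×ˢ (Finset.univ : Finset (Fin n)) ×ˢ Finset.range ℓ ×ˢ Finset.range ℓ).filter (fun t => t.1.foldl (fun v c => μ c v) t.2.1 = t.2.1 ∧ t.1.foldl (fun v c => μ c v) t.2.2.1 = t.2.2.1 ∧ t.2.1 ≠ t.2.2.1 ∧ (t.1.take t.2.2.2.1).foldl (fun v c => μ c v) t.2.1 = (t.1.take t.2.2.2.2).foldl (fun v c => μ c v) t.2.2.1)).card ≤ ℓ * (((((Finset.univ : Finset (List.Vector (Fin 3) ℓ)).image (fun v => v.toList)).filter (fun z => List.IsChain (· ≠ ·) (z ++ z))) ×ˢ (Finset.univ : Finset (Fin n)) ×ˢ Finset.range ℓ).filter (fun t =>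 0 < t.2.2 ∧ t.1.foldl (fun v c => μ c v) t.2.1 = t.2.1 ∧ t.1.foldl (fun v c => μ c v) ((t.1.take t.2.2).foldl (fun v c => μ c v) t.2.1) = (t.1.take t.2.2).foldl (fun v c => μ c v) t.2.1 ∧ (t.1.take t.2.2).foldl (fun v c => μ c v) t.2.1 ≠ t.2.1)).card :=
  fun _ ℓ μ hμ => crossInc_le μ hμ ℓ

end TwinsEll2

end Summit.MatrixMultiplication.MatrixMultiplication.Theorems.HyperoctahedralThreshold
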